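import Mathlib
import Summits.Ventures.PercRepro2.HCov
import Summits.Ventures.PercRepro2.BHKAvoid
import Summits.Ventures.PercRepro2.BHKOutside
import Summits.Ventures.PercRepro2.ISplit
import Summits.Ventures.PercRepro2.RootLeafUHalf
import Summits.Ventures.PercRepro2.RootLeafUOu
import Summits.Ventures.PercRepro2.RootLeafUClaimI
import Summits.Ventures.PercRepro2.RootLeafUKMaster
import Summits.Ventures.PercRepro2.RootLeafUKSide
import Summits.Ventures.PercRepro2.RootLeafUClaimITp
import Summits.Ventures.PercRepro2.RootLeafUClaimPD

/-!
# The `b ∈ L` half `(II)` of the `L` side's four-mark claim `(m2)` is a THEOREM (blind cell PercRepro2,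
p4 g30; S3 (G4-u) item (ap), proofs/P4-G30-HALVES.md)

Vocabulary of RootLeafUClaimPD (`u = a₁` the root pendant at the unmarked `u`, `c = a₃`): `Q = {a₂ ↮ u}`,
`Z = P(Q)`, `PD = Q ∩ {c ∉ K ∪ L}`, `T = Q ∩ {c ∈ K}`, `T′ = Q ∩ {c ∈ L}`, masses `D, t, t′`, `W = D + t = P(R)`
(`R = {u ↮ a₂, u ↮ c}`), `W′ = D + t′ = P(R′)` (`R′ = {a₂ ↮ u, a₂ ↮ c}`), `d0 = P(a₂ ↮ c)`, `β = D + d0·Z`.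

The four-mark claim `(m2)` of RootLeafULSidePD splits EXACTLY as `(m2) = (II) + (I′)` with

  `(II) := 2·D·W·[(1 − d0)·P(Q,bL) − P(T,bL)] − β·[t·P(PD,bL) − D·P(T,bL)]`

(the `b ∈ L`-only half: `2·A3 − RHS` in the clean form `(m2)/2 = A1 + A2 + A3 − RHS`, where `A3 = D·W·S3`,
`S3 = P(a₂ ↔ c)·P(Q,bL) − P(T,bL)` and `RHS = β·Γ`, `Γ = t·P(PD,bL) − D·P(T,bL)` the drop of `P(b ∈ L | R)` when
`c ∈ K`).  This file proves **`0 ≤ (II)`** on every finite graph and weight vector, by the certificate identity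
(`halfII_identity`, a `ring` identity after `Qsplit`, `Qsplit_univ`, `prob_Rp_inter`, the split of `{a₂ ↔ c}` by
`{a₂ ↔ u}`):

  `(II) = h·W·P(PD,bL) + t′·W·d0·P(T,bL) + D·(1 − d0)·[Z·P(T′,bL) − t′·P(Q,bL)]
          + (1 − d0)·W·[W′·P(T′,bL) − t′·P(R′,bL)] + W′·P(R,bL)·[W·(1 − d0) − t]`

with the four signs: `h = P(a₂ ↔ u, a₂ ↔ c) − P(a₂ ↔ u)·P(a₂ ↔ c) ≥ 0` (Harris, `harris_uc`); the two brackets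
`Z·P(T′,bL) ≥ t′·P(Q,bL)` and `W′·P(T′,bL) ≥ t′·P(R′,bL)` (BHK06 1.3 through the exploration of `K`: the two events
`{c ∈ L}`, `{b ∈ L}` of the complement of `K` are positively correlated given `a₂ ↮ u`, resp. `a₂ ↮ {u, c}` —
`bhk_two_outside_avoid` with the same outside vertex `u` in both slots, `Tp_bL_mul_Z_ge`, `Tp_bL_mul_Wp_ge`); and
`W·(1 − d0) ≥ t` (Harris, `R` decreasing against `{a₂ ↔ c}`, `T_le_W_mul`).  The certificate was found by a
symbolic LP over the four-root BHK/Harris library (kit j329850) and re-solved exactly; its equality locus is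
`c` pendant at `a₂` (and `b` pendant at `a₂`).  The other half `(I′) = 2·(A1 + A2) − RHS` (the `b ∈ K` slacks
against the same drop) is NOT proved here.
-/

namespace Summit.Ventures.PercRepro2

open UnionCluster CovForm

namespace RootLeafU

namespace LSideII

variable {V : Type*} {E : Type*} [Fintype E] [DecidableEq E] [Fintype V] [DecidableEq V]
  {R : Type*} [Field R] [LinearOrder R] [IsStrictOrderedRing R]

variable (p : E → R) (ends : E → Sym2 V) (a₂ c b u : V)

omit [Fintype E] [DecidableEq E] [Fintype V] [DecidableEq V] [LinearOrder R] [IsStrictOrderedRing R] in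
/-- `{a₂ ↮ u} = {a₂ ↔ u}ᶜ`. -/
lemma avoid_u_eq_compl : avoidAll ends a₂ {u} = (connEvent ends a₂ u)ᶜ := by
  ext ω
  simp only [mem_avoidAll, Finset.mem_singleton, forall_eq, Set.mem_compl_iff, mem_connEvent]

omit [Fintype E] [DecidableEq E] [Fintype V] [DecidableEq V] [LinearOrder R] [IsStrictOrderedRing R] in
/-- `{u ↔ c} ∩ {u ↔ b} ∩ {a₂ ↮ u} = T′ ∩ {u ↔ b}`. -/
lemma cL_inter_bL_inter_Q_eq_Tp_bL :
    connEvent ends u c ∩ connEvent ends u b ∩ avoidAll ends a₂ {u} =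
      TEvent ends a₂ u c ∩ connEvent ends u b := by
  rw [Set.inter_right_comm, LMaster.cL_inter_Q_eq_Tp]

omit [Fintype E] [DecidableEq E] [Fintype V] [LinearOrder R] [IsStrictOrderedRing R] in
/-- `{u ↔ c} ∩ {u ↔ b} ∩ {a₂ ↮ {u, c}} = T′ ∩ {u ↔ b}`. -/
lemma cL_inter_bL_inter_Rp_eq_Tp_bL :
    connEvent ends u c ∩ connEvent ends u b ∩ avoidAll ends a₂ {u, c} =
      TEvent ends a₂ u c ∩ connEvent ends u b := by
  rw [Set.inter_right_comm, KMaster.conn_inter_avoid_eq_Tp']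

omit [Fintype V] [DecidableEq V] in
/-- **Harris**: `P(a₂ ↔ u)·P(a₂ ↔ c) ≤ P(a₂ ↔ u, a₂ ↔ c)`. -/
lemma harris_uc (hp : IsProbVec p) :
    prob p (connEvent ends a₂ u) * prob p (connEvent ends a₂ c) ≤
      prob p (connEvent ends a₂ u ∩ connEvent ends a₂ c) :=
  prob_mul_prob_le_prob_inter hp (isUpperSet_connEvent ends a₂ u) (isUpperSet_connEvent ends a₂ c)

omit [Fintype V] [DecidableEq V] in
/-- **`P(a₂ ↔ c) = t + P(a₂ ↔ u, a₂ ↔ c)`**: the split of `{a₂ ↔ c}` by `{a₂ ↔ u}`. -/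
lemma prob_cK_split :
    prob p (connEvent ends a₂ c) =
      prob p (TEvent ends u a₂ c) + prob p (connEvent ends a₂ u ∩ connEvent ends a₂ c) := by
  have h := prob_inter_add_prob_inter_compl p (connEvent ends a₂ c) (connEvent ends a₂ u)
  have e : connEvent ends a₂ c ∩ (connEvent ends a₂ u)ᶜ = TEvent ends u a₂ c := by
    rw [TEvent, Set.inter_comm]
  rw [e, Set.inter_comm] at h
  linarith

omit [DecidableEq V] in
/-- **BHK06 1.3 under `Q`, two outside events**: `t′·P(Q,bL) ≤ Z·P(T′,bL)` — `{c ∈ L}` and `{b ∈ L}` are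
positively correlated given `a₂ ↮ u` (`bhk_two_outside_avoid`, the same outside vertex `u` twice). -/
lemma Tp_bL_mul_Z_ge (hp : IsProbVec p) :
    prob p (TEvent ends a₂ u c) * prob p (avoidAll ends a₂ {u} ∩ connEvent ends u b) ≤
      prob p (TEvent ends a₂ u c ∩ connEvent ends u b) * prob p (avoidAll ends a₂ {u}) := by
  classical
  have h := bhk_two_outside_avoid p hp ends a₂ u u ({u} : Finset V)
    (isUpperSet_mem_setOf c) (isUpperSet_mem_setOf b)
  have e : insert u ({u} : Finset V) = {u} := Finset.insert_eq_of_mem (Finset.mem_singleton_self u)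
  simp only [e] at h
  rw [← connEvent_eq_clusterInEvent ends u c, ← connEvent_eq_clusterInEvent ends u b,
    LMaster.cL_inter_Q_eq_Tp, cL_inter_bL_inter_Q_eq_Tp_bL, Set.inter_comm (connEvent ends u b)] at h
  exact h

/-- **BHK06 1.3 under `R′`, two outside events**: `t′·P(R′,bL) ≤ W′·P(T′,bL)` — `{c ∈ L}` and `{b ∈ L}` are
positively correlated given `a₂ ↮ {u, c}`. -/
lemma Tp_bL_mul_Wp_ge (hp : IsProbVec p) :
    prob p (TEvent ends a₂ u c) * prob p (avoidAll ends a₂ {u, c} ∩ connEvent ends u b) ≤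
      prob p (TEvent ends a₂ u c ∩ connEvent ends u b) * prob p (avoidAll ends a₂ {u, c}) := by
  classical
  have h := bhk_two_outside_avoid p hp ends a₂ u u ({u, c} : Finset V)
    (isUpperSet_mem_setOf c) (isUpperSet_mem_setOf b)
  have e : insert u ({u, c} : Finset V) = {u, c} :=
    Finset.insert_eq_of_mem (Finset.mem_insert_self u {c})
  simp only [e] at h
  rw [← connEvent_eq_clusterInEvent ends u c, ← connEvent_eq_clusterInEvent ends u b,
    KMaster.conn_inter_avoid_eq_Tp', cL_inter_bL_inter_Rp_eq_Tp_bL,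
    Set.inter_comm (connEvent ends u b)] at h
  exact h

omit [Fintype V] in
/-- **Harris**: `t ≤ W·P(a₂ ↔ c)` — `R = {u ↮ a₂, u ↮ c}` is decreasing, `{a₂ ↔ c}` increasing,
`R ∩ {a₂ ↔ c} = T`. -/
lemma T_le_W_mul (hp : IsProbVec p) :
    prob p (TEvent ends u a₂ c) ≤
      (prob p (PDEvent ends u a₂ c) + prob p (TEvent ends u a₂ c)) * prob p (connEvent ends a₂ c) := by
  have h := prob_inter_le_prob_mul_prob_of_isLowerSet hp (isLowerSet_avoidAll_finset ends u {a₂, c})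
    (isUpperSet_connEvent ends a₂ c)
  rw [Set.inter_comm, PDLevel.cK_inter_R_eq_T] at h
  have hR := ISplit.prob_PD_add_T p ends u a₂ c Set.univ
  simp only [Set.inter_univ] at hR
  rw [hR]
  exact h

omit [Fintype V] in
/-- **The certificate identity of `(II)`** in the free variables `D, t, t′, ζ = P(a₂ ↔ u, a₂ ↔ c)` and the three
`b ∈ L` cells, after the splits `Z = D + t + t′` and `P(a₂ ↔ c) = t + ζ`. -/
theorem halfII_identity :
    2 * prob p (PDEvent ends u a₂ c) * (prob p (PDEvent ends u a₂ c) + prob p (TEvent ends u a₂ c)) * ((1 - prob p (avoidAll ends a₂ {c})) * (prob p (PDEvent ends u a₂ c ∩ connEvent ends u b) + prob p (TEvent ends u a₂ c ∩ connEvent ends u b) + prob p (TEvent ends a₂ u c ∩ connEvent ends u b)) - prob p (TEvent ends u a₂ c ∩ connEvent ends u b)) - (prob p (PDEvent ends u a₂ c) + prob p (avoidAll ends a₂ {c}) * prob p (avoidAll ends a₂ {u})) * (prob p (TEvent ends u a₂ c) * prob p (PDEvent ends u a₂ c ∩ connEvent ends u b) - prob p (PDEvent ends u a₂ c) * prob p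 (TEvent ends u a₂ c ∩ connEvent ends u b)) =
      (prob p (connEvent ends a₂ u ∩ connEvent ends a₂ c) - (1 - prob p (avoidAll ends a₂ {u})) * (1 - prob p (avoidAll ends a₂ {c}))) * (prob p (PDEvent ends u a₂ c) + prob p (TEvent ends u a₂ c)) * prob p (PDEvent ends u a₂ c ∩ connEvent ends u b)
      + prob p (TEvent ends a₂ u c) * (prob p (PDEvent ends u a₂ c) + prob p (TEvent ends u a₂ c)) * prob p (avoidAll ends a₂ {c}) * prob p (TEvent ends u a₂ c ∩ connEvent ends u b)
      + prob p (PDEvent ends u a₂ c) * (1 - prob p (avoidAll ends a₂ {c})) * (prob p (avoidAll ends a₂ {u}) * prob p (TEvent ends a₂ u c ∩ connEvent ends u b) - prob p (TEvent ends a₂ u c) * (prob p (PDEvent ends u a₂ c ∩ connEvent ends u b) + prob p (TEvent ends u a₂ c ∩ connEvent ends u b) + prob p (TEvent ends a₂ u c ∩ connEvent ends u b)))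
      + (1 - prob p (avoidAll ends a₂ {c})) * (prob p (PDEvent ends u a₂ c) + prob p (TEvent ends u a₂ c)) * ((prob p (PDEvent ends u a₂ c) + prob p (TEvent ends a₂ u c)) * prob p (TEvent ends a₂ u c ∩ connEvent ends u b) - prob p (TEvent ends a₂ u c) * (prob p (PDEvent ends u a₂ c ∩ connEvent ends u b) + prob p (TEvent ends a₂ u c ∩ connEvent ends u b)))
      + (prob p (PDEvent ends u a₂ c) + prob p (TEvent ends a₂ u c)) * (prob p (PDEvent ends u a₂ c ∩ connEvent ends u b) + prob p (TEvent ends u a₂ c ∩ connEvent ends u b)) * ((prob p (PDEvent ends u a₂ c) + prob p (TEvent ends u a₂ c)) * (1 - prob p (avoidAll ends a₂ {c})) - prob p (TEvent ends u a₂ c)) := by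
  have hZ := Qsplit_univ p ends u a₂ c
  have hd0 : prob p (avoidAll ends a₂ {c}) = 1 - prob p (connEvent ends a₂ c) := by
    rw [LMaster.avoid_c_eq_compl, prob_compl]
  have hcK := prob_cK_split p ends a₂ c u
  rw [hZ, hd0, hcK]
  ring

/-- **`0 ≤ (II)`: the `b ∈ L` half of the four-mark claim `(m2)`, on every instance**:
`β·[t·P(PD,bL) − D·P(T,bL)] ≤ 2·D·W·[(1 − d0)·P(Q,bL) − P(T,bL)]` (in the split masses,
`P(Q,bL) = P(PD,bL) + P(T,bL) + P(T′,bL)`). -/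
theorem halfII (hp : IsProbVec p) :
    (prob p (PDEvent ends u a₂ c) + prob p (avoidAll ends a₂ {c}) * prob p (avoidAll ends a₂ {u})) * (prob p (TEvent ends u a₂ c) * prob p (PDEvent ends u a₂ c ∩ connEvent ends u b) - prob p (PDEvent ends u a₂ c) * prob p (TEvent ends u a₂ c ∩ connEvent ends u b)) ≤
      2 * prob p (PDEvent ends u a₂ c) * (prob p (PDEvent ends u a₂ c) + prob p (TEvent ends u a₂ c)) * ((1 - prob p (avoidAll ends a₂ {c})) * (prob p (PDEvent ends u a₂ c ∩ connEvent ends u b) + prob p (TEvent ends u a₂ c ∩ connEvent ends u b) + prob p (TEvent ends a₂ u c ∩ connEvent ends u b)) - prob p (TEvent ends u a₂ c ∩ connEvent ends u b)) := by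
  classical
  rw [← sub_nonneg, halfII_identity]
  -- nonnegative masses
  have n_D := prob_nonneg hp (PDEvent ends u a₂ c)
  have n_t := prob_nonneg hp (TEvent ends u a₂ c)
  have n_tp := prob_nonneg hp (TEvent ends a₂ u c)
  have n_d0 := prob_nonneg hp (avoidAll ends a₂ {c})
  have hd0_le := prob_le_one hp (avoidAll ends a₂ {c})
  have n_PDb := prob_nonneg hp (PDEvent ends u a₂ c ∩ connEvent ends u b)
  have n_Tb := prob_nonneg hp (TEvent ends u a₂ c ∩ connEvent ends u b)
  have n_W : 0 ≤ prob p (PDEvent ends u a₂ c) + prob p (TEvent ends u a₂ c) := add_nonneg n_D n_t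
  have n_Wp : 0 ≤ prob p (PDEvent ends u a₂ c) + prob p (TEvent ends a₂ u c) := add_nonneg n_D n_tp
  have n_Rb : 0 ≤ prob p (PDEvent ends u a₂ c ∩ connEvent ends u b) + prob p (TEvent ends u a₂ c ∩ connEvent ends u b) :=
    add_nonneg n_PDb n_Tb
  have n_1d0 : 0 ≤ 1 - prob p (avoidAll ends a₂ {c}) := by linarith
  -- (1) Harris `h ≥ 0`
  have hU : prob p (connEvent ends a₂ u) = 1 - prob p (avoidAll ends a₂ {u}) := by
    rw [avoid_u_eq_compl, prob_compl]; ring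
  have hC : prob p (connEvent ends a₂ c) = 1 - prob p (avoidAll ends a₂ {c}) := by
    rw [LMaster.avoid_c_eq_compl, prob_compl]; ring
  have H1 := harris_uc p ends a₂ c u hp
  rw [hU, hC] at H1
  have g1 : 0 ≤ (prob p (connEvent ends a₂ u ∩ connEvent ends a₂ c) - (1 - prob p (avoidAll ends a₂ {u})) * (1 - prob p (avoidAll ends a₂ {c}))) * (prob p (PDEvent ends u a₂ c) + prob p (TEvent ends u a₂ c)) * prob p (PDEvent ends u a₂ c ∩ connEvent ends u b) :=
    mul_nonneg (mul_nonneg (by linarith) n_W) n_PDb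
  -- (2) the trivial term
  have g2 : 0 ≤ prob p (TEvent ends a₂ u c) * (prob p (PDEvent ends u a₂ c) + prob p (TEvent ends u a₂ c)) * prob p (avoidAll ends a₂ {c}) * prob p (TEvent ends u a₂ c ∩ connEvent ends u b) :=
    mul_nonneg (mul_nonneg (mul_nonneg n_tp n_W) n_d0) n_Tb
  -- (3) BHK under `Q`
  have H3 := Tp_bL_mul_Z_ge p ends a₂ c b u hp
  rw [Qsplit p ends u a₂ c (connEvent ends u b)] at H3
  have g3 : 0 ≤ prob p (PDEvent ends u a₂ c) * (1 - prob p (avoidAll ends a₂ {c})) * (prob p (avoidAll ends a₂ {u}) * prob p (TEvent ends a₂ u c ∩ connEvent ends u b) - prob p (TEvent ends a₂ u c) * (prob p (PDEvent ends u a₂ c ∩ connEvent ends u b) + prob p (TEvent ends u a₂ c ∩ connEvent ends u b) + prob p (TEvent ends a₂ u c ∩ connEvent ends u b))) :=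
    mul_nonneg (mul_nonneg n_D n_1d0) (by linarith)
  -- (4) BHK under `R′`
  have H4 := Tp_bL_mul_Wp_ge p ends a₂ c b u hp
  rw [← KMaster.prob_Rp_inter p ends a₂ c u (connEvent ends u b), ← KMaster.prob_Rp p ends a₂ c u] at H4
  have g4 : 0 ≤ (1 - prob p (avoidAll ends a₂ {c})) * (prob p (PDEvent ends u a₂ c) + prob p (TEvent ends u a₂ c)) * ((prob p (PDEvent ends u a₂ c) + prob p (TEvent ends a₂ u c)) * prob p (TEvent ends a₂ u c ∩ connEvent ends u b) - prob p (TEvent ends a₂ u c) * (prob p (PDEvent ends u a₂ c ∩ connEvent ends u b) + prob p (TEvent ends a₂ u c ∩ connEvent ends u b))) :=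
    mul_nonneg (mul_nonneg n_1d0 n_W) (by linarith)
  -- (5) Harris `t ≤ W·(1 − d0)`
  have H5 := T_le_W_mul p ends a₂ c u hp
  rw [hC] at H5
  have g5 : 0 ≤ (prob p (PDEvent ends u a₂ c) + prob p (TEvent ends a₂ u c)) * (prob p (PDEvent ends u a₂ c ∩ connEvent ends u b) + prob p (TEvent ends u a₂ c ∩ connEvent ends u b)) * ((prob p (PDEvent ends u a₂ c) + prob p (TEvent ends u a₂ c)) * (1 - prob p (avoidAll ends a₂ {c})) - prob p (TEvent ends u a₂ c)) :=
    mul_nonneg (mul_nonneg n_Wp n_Rb) (by linarith)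
  linarith

end LSideII

end RootLeafU

end Summit.Ventures.PercRepro2
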